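import Summits.NavierStokesRegularity.NavierStokesRegularity.Theorems.CoriolisHeadNoCoRotatingCorePosPart
import Summits.NavierStokesRegularity.NavierStokesRegularity.Theorems.CoriolisHeadNoCoRotatingCoreReduction
import Summits.NavierStokesRegularity.NavierStokesRegularity.Theorems.CoriolisHeadCounterRotatingLiouvilleHeadGrowth
import Literature.Analysis.FluidPDE.VectorCalculusProofs
import Literature.Analysis.FluidPDE.CurlFreeLiouville

/-!
# Route CoriolisHead · crux `NoCoRotatingCore` (stmt-NavierStokesRegularity-22676) —
# the skeleton's composition, and trading the Coriolis defect for the strain feed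

Support file (`--supports stmt-NavierStokesRegularity-22676`, helper; theorems only, no definitions,
no named facts).  Two things.

1. **Composition of the registered skeleton.**  With `stub_spinVorticityIdentity` (p588391) and
   `stub_posPartMaxPrinciple` (p590390) landed, the birth skeleton of the crux reduces
   `NoCoRotatingCore` to its one open stub `stub_noStrainFedCore`, stated here as an explicit
   hypothesis (`noCoRotatingCore_of_noStrainFedCore`): if every smooth bounded rotated Leray profile
   has strain feed `⟪β, DU[curl U]⟫ < 2a ω_β` on its co-rotating set `{ω_β > 0}`
   (`ω_β = −Σₗ (B ∂ₗU)ₗ = ⟪β, curl U⟫` the spin vorticity), then `NoCoRotatingCore`.  The proof is the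
   skeleton's: on `{ω_β > 0}` the spin-vorticity equation `L ω_β = 2a ω_β − ⟪β, DU[curl U]⟫` makes
   `ω_β` a strict subsolution, and the damped maximum principle gives `ω_β ≤ 0`.

2. **The Coriolis defect is removable; the strain feed is not.**  The rotating head
   `Π_B = ½|U|² + P + a⟨y,U⟩ − ⟨By,U⟩` has `L Π_B = ν|ω|² − 2ν ω_β` (landed identity, `|ω|²` written
   as `½ Σ (∂ₗUᵢ − ∂ᵢUₗ)²`), the only unsigned term being the LINEAR Coriolis defect `−2ν ω_β`; adding
   `(ν/a) ω_β` cancels it exactly (`driftOp_rotatingHead_add_spin_eq`):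

     `L (Π_B + (ν/a) ω_β) = ν |ω|² − (ν/a) ⟪β, DU ω⟫`,

   so the obstruction to Tsai's maximum-principle proof at rotation rate `β ≠ 0` is precisely the
   STRAIN FEED `⟪β, DU ω⟫ = ⟪β, Sω⟫` of the spin vorticity — a vortex-stretching quantity — and
   nothing else.  Consequence (`rotatedProfile_const_of_spinFeed_lt`): a smooth bounded rotated
   profile with `⟪β, DU(y) ω(y)⟫ < a |ω(y)|²` wherever `ω(y) ≠ 0` is constant (any skew `B`); note
   the hypothesis is automatic where `|ω| > |β| ‖DU‖/a`, i.e. it only constrains the weakly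
   vortical region.  With `noCoRotatingCore_iff_rotatedProfileLiouville` this is a second reduction
   of the crux (`noCoRotatingCore_of_spinFeed_lt`), next to the stretching threshold
   `⟪ω, DU ω⟫ < 2a|ω|²` of `CoriolisHeadNoCoRotatingCoreStrainThreshold`.

HONEST FRAMING. Reductions and an identity; the open stub `stub_noStrainFedCore`, the crux
`NoCoRotatingCore` (≡ bounded rotated-profile Liouville `X`, Pineau–Vicol 2026 Conj. 1.1 in bounded
all-rotation-rates form) and Navier–Stokes regularity are NOT proved here.

References: T.-P. Tsai, ARMA 143 (1998), (1.7) and Lemma 5.1 [Tsai1998]; B. Pineau, V. Vicol,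
arXiv:2607.09619, Conj. 1.1, p. 4 [PineauVicol2026]; KNSS, Acta Math. 203 (2009), Lemma 3.1 [KNSS2009].
-/

noncomputable section

-- the summit and its single sub-problem share the name (CONVENTIONS §1), as in every Theorems file
set_option linter.dupNamespace false

open MeasureTheory Set Function Filter Topology InnerProductSpace Metric
open scoped RealInnerProductSpace Laplacian ContDiff BigOperators
open Literature.Analysis.FluidPDE

namespace Summit.NavierStokesRegularity.NavierStokesRegularity.Theorems.CoriolisHead

/-! ### 1. The skeleton's composition: `NoCoRotatingCore` from its open stub -/

/-- **`NoCoRotatingCore` from the open stub `stub_noStrainFedCore`.**  The registered birth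
skeleton of crux stmt-NavierStokesRegularity-22676 composed with its two landed stubs
(`stub_spinVorticityIdentity`, `stub_posPartMaxPrinciple`): if for every smooth bounded rotated
Leray profile the strain feed of the co-rotating core is sub-threshold,
`⟪β, DU[curl U]⟫ < 2a ω_β` on `{ω_β > 0}`, then the spin vorticity `ω_β = −Σₗ (B ∂ₗU)ₗ` is `≤ 0`
everywhere, i.e. `tr(B∘DU) ≥ 0`: `NoCoRotatingCore`.  (The hypothesis is the verbatim signature of
the open stub; nothing about it is proved here.) [cite: PineauVicol2026, Conjecture 1.1 (arXiv:2607.09619 p. 3)] -/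
theorem noCoRotatingCore_of_noStrainFedCore
    (h : ∀ (ν a : ℝ), 0 < ν → 0 < a → ∀ (B : EuclideanSpace ℝ (Fin 3) →L[ℝ] EuclideanSpace ℝ (Fin 3))
      (U : EuclideanSpace ℝ (Fin 3) → EuclideanSpace ℝ (Fin 3)) (P : EuclideanSpace ℝ (Fin 3) → ℝ),
      ContDiff ℝ (⊤ : ℕ∞) U → ContDiff ℝ 2 P → (∀ x, inner ℝ (B x) x = 0) →
      Literature.Analysis.FluidPDE.VectorCalculus.IsDivFree U →
      (∀ y, -(ν • Laplacian.laplacian U y) + a • U y + a • fderiv ℝ U y y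
        + (B (U y) - fderiv ℝ U y (B y)) + Literature.Analysis.FluidPDE.convect U U y
        + gradient P y = 0) →
      (∃ M : ℝ, ∀ y, ‖U y‖ ≤ M) →
      ∀ y, 0 < (fun z => -(∑ l, (B (fderiv ℝ U z (EuclideanSpace.single l 1))) l)) y →
        inner ℝ (WithLp.toLp 2 ![(B (EuclideanSpace.single 1 1)) 2, (B (EuclideanSpace.single 2 1)) 0,
          (B (EuclideanSpace.single 0 1)) 1] : EuclideanSpace ℝ (Fin 3))
          (fderiv ℝ U y (Literature.Analysis.FluidPDE.curl U y))
        < 2 * a * ((fun z => -(∑ l, (B (fderiv ℝ U z (EuclideanSpace.single l 1))) l)) y)) :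
    Summit.NavierStokesRegularity.NavierStokesRegularity.Theses.CoriolisHead.NoCoRotatingCore := by
  intro ν a hν ha B U P hU hP hB hdiv heq hbdd y
  -- on the co-rotating set the spin vorticity is a strict subsolution
  have hpos : ∀ y, 0 < (fun z => -(∑ l, (B (fderiv ℝ U z (EuclideanSpace.single l 1))) l)) y →
      0 < driftOp ν a (fun z => U z - B z)
        (fun z => -(∑ l, (B (fderiv ℝ U z (EuclideanSpace.single l 1))) l)) y := by
    intro y hy
    rw [stub_spinVorticityIdentity ν a B U P hU hP hB hdiv heq y]
    have hlt := h ν a hν ha B U P hU hP hB hdiv heq hbdd y hy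
    linarith
  -- damped maximum principle: the spin vorticity is `≤ 0`
  have hle := stub_posPartMaxPrinciple ν a hν ha B U P hU hP hB hdiv heq hbdd hpos y
  simp only [neg_nonpos] at hle
  exact hle

/-! ### 2. Trading the Coriolis defect for the strain feed -/

section Trade

variable {ν a : ℝ}

/-- Linearity of the drift operator on `C²` functions: `L(f + c g) = Lf + c Lg`. -/
theorem driftOp_add_mul (V : EuclideanSpace ℝ (Fin 3) → EuclideanSpace ℝ (Fin 3))
    {f g : EuclideanSpace ℝ (Fin 3) → ℝ} (hf : ContDiff ℝ 2 f) (hg : ContDiff ℝ 2 g) (c : ℝ)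
    (y : EuclideanSpace ℝ (Fin 3)) :
    driftOp ν a V (fun z => f z + c * g z) y = driftOp ν a V f y + c * driftOp ν a V g y := by
  have hcg : ContDiff ℝ 2 (fun z => c * g z) := contDiff_const.mul hg
  have hfd : DifferentiableAt ℝ f y := (hf.differentiable (by norm_num)) y
  have hgd : DifferentiableAt ℝ g y := (hg.differentiable (by norm_num)) y
  have hcgd : DifferentiableAt ℝ (fun z => c * g z) y := (hcg.differentiable (by norm_num)) y
  have L1 : (Δ (fun z => f z + c * g z)) y = (Δ f) y + (Δ (fun z => c * g z)) y :=
    hf.contDiffAt.laplacian_add hcg.contDiffAt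
  have L2 : (Δ (fun z => c * g z)) y = c * (Δ g) y := by
    have : (fun z => c * g z) = c • g := by funext z; simp [smul_eq_mul]
    rw [this, InnerProductSpace.laplacian_smul c hg.contDiffAt, smul_eq_mul]
  have D1 : fderiv ℝ (fun z => f z + c * g z) y = fderiv ℝ f y + fderiv ℝ (fun z => c * g z) y :=
    fderiv_fun_add hfd hcgd
  have D2 : fderiv ℝ (fun z => c * g z) y = c • fderiv ℝ g y := by
    have : (fun z => c * g z) = c • g := by funext z; simp [smul_eq_mul]
    rw [this, fderiv_const_smul hgd c]
  unfold driftOp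
  rw [L1, L2, D1, D2]
  simp only [FunLike.coe_add, Pi.add_apply, FunLike.coe_smul, Pi.smul_apply,
    smul_eq_mul]
  ring

variable {B : EuclideanSpace ℝ (Fin 3) →L[ℝ] EuclideanSpace ℝ (Fin 3)}
  {U : EuclideanSpace ℝ (Fin 3) → EuclideanSpace ℝ (Fin 3)} {P : EuclideanSpace ℝ (Fin 3) → ℝ}

/-- `Σₗᵢ (∂ₗUᵢ − ∂ᵢUₗ)² = 2 |curl U|²` on `ℝ³` (`= |DU − DUᵀ|²`, Majda–Bertozzi (1.22)–(1.24)). -/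
theorem sum_sq_pderiv_sub_eq_two_mul_norm_curl_sq {y : EuclideanSpace ℝ (Fin 3)}
    (hU : DifferentiableAt ℝ U y) :
    ∑ l, ∑ i, (pderiv l (fun z => U z i) y - pderiv i (fun z => U z l) y) ^ 2
      = 2 * ‖curl U y‖ ^ 2 := by
  rw [← frobeniusNormSq_spin_eq_sum hU, norm_curl_sq_eq_frobeniusNormSq_spin_holds U y hU]
  ring

/-- **The Coriolis defect is removable.**  For a smooth divergence-free solution `(U, P)` (`P ∈ C²`)
of the rotated Leray profile system with `B` skew, axial vector `β`, spin vorticity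
`ω_β = −Σₗ (B ∂ₗU)ₗ = ⟪β, curl U⟫`, rotating head `Π_B = ½|U|² + P + a⟨y,U⟩ − ⟨By,U⟩` and
`a ≠ 0`:  `L (Π_B + (ν/a) ω_β) = ν |curl U|² − (ν/a) ⟪β, DU[curl U]⟫`, `L = νΔ − D·[U − By + ay]`
(the linear defect `−2ν ω_β` of `L Π_B` against the damping `2a ω_β` of `L ω_β`).
[cite: Tsai1998, (1.7) (the case B = 0)] -/
theorem driftOp_rotatingHead_add_spin_eq (hU : ContDiff ℝ (⊤ : ℕ∞) U) (hP : ContDiff ℝ 2 P)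
    (hB : ∀ x, ⟪B x, x⟫ = 0) (hdiv : VectorCalculus.IsDivFree U)
    (heq : ∀ y, -(ν • Laplacian.laplacian U y) + a • U y + a • fderiv ℝ U y y
      + (B (U y) - fderiv ℝ U y (B y)) + convect U U y + gradient P y = 0)
    (ha : a ≠ 0) (y : EuclideanSpace ℝ (Fin 3)) :
    driftOp ν a (fun z => U z - B z)
        (fun z => (headPressure a U P z - ⟪B z, U z⟫)
          + (ν / a) * (-(∑ l, (B (fderiv ℝ U z (EuclideanSpace.single l 1))) l))) y
      = ν * ‖curl U y‖ ^ 2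
        - (ν / a) * ⟪(WithLp.toLp 2 ![(B (EuclideanSpace.single 1 1)) 2, (B (EuclideanSpace.single 2 1)) 0,
            (B (EuclideanSpace.single 0 1)) 1] : EuclideanSpace ℝ (Fin 3)), fderiv ℝ U y (curl U y)⟫ := by
  have hU2 : ContDiff ℝ 2 U := hU.of_le (by norm_cast)
  have hU3 : ContDiff ℝ 3 U := hU.of_le (by norm_cast)
  have hω2 : ContDiff ℝ 2 (curl U) := contDiff_curl (n := 2) (by exact_mod_cast hU3)
  have hΘ : ContDiff ℝ 2 (fun z => headPressure a U P z - ⟪B z, U z⟫) :=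
    (contDiff_headPressure hU2 hP).sub ((B.contDiff (n := 2)).inner ℝ hU2)
  have hspin : (fun z => -(∑ l, (B (fderiv ℝ U z (EuclideanSpace.single l 1))) l))
      = fun z => ⟪(WithLp.toLp 2 ![(B (EuclideanSpace.single 1 1)) 2, (B (EuclideanSpace.single 2 1)) 0,
          (B (EuclideanSpace.single 0 1)) 1] : EuclideanSpace ℝ (Fin 3)), curl U z⟫ :=
    funext fun z => by
      rw [curl_eq_curlCLM]; exact neg_sum_clm_apply_eq_inner_axial_curlCLM B hB _
  have hσ2 : ContDiff ℝ 2 (fun z => -(∑ l, (B (fderiv ℝ U z (EuclideanSpace.single l 1))) l)) := by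
    rw [hspin]; exact contDiff_const.inner ℝ hω2
  rw [driftOp_add_mul _ hΘ hσ2, stub_rotatingHeadIdentity ν a B U P hU hP hB hdiv heq y,
    stub_spinVorticityIdentity ν a B U P hU hP hB hdiv heq y,
    sum_sq_pderiv_sub_eq_two_mul_norm_curl_sq ((hU.differentiable (by simp)) y)]
  field_simp
  ring

/-- **Spin-feed Liouville theorem for bounded rotated profiles (any rotation rate).**  A smooth
bounded rotated Leray profile (`ν, a > 0`, skew `B` of any size with axial vector `β`) whose strain
feed on the spin direction satisfies `⟪β, DU(y) ω(y)⟫ < a |ω(y)|²` wherever `ω(y) = curl U(y) ≠ 0`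
is constant: `Π_B + (ν/a) ω_β` is then a polynomially bounded subsolution
(`driftOp_rotatingHead_add_spin_eq`, `stub_rssHeadGrowth`, `rotatedProfile_poly_bound_fderiv`),
constant by Tsai's Lemma 5.1 for the skew drift, forcing `ω ≡ 0`; then KNSS Lemma 3.1.
[cite: Tsai1998, Lemma 5.1; KNSS2009, Lemma 3.1] -/
theorem rotatedProfile_const_of_spinFeed_lt (ν a : ℝ) (hν : 0 < ν) (ha : 0 < a)
    (B : EuclideanSpace ℝ (Fin 3) →L[ℝ] EuclideanSpace ℝ (Fin 3))
    (U : EuclideanSpace ℝ (Fin 3) → EuclideanSpace ℝ (Fin 3)) (P : EuclideanSpace ℝ (Fin 3) → ℝ)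
    (hU : ContDiff ℝ (⊤ : ℕ∞) U) (hP : ContDiff ℝ 2 P) (hB : ∀ x, inner ℝ (B x) x = 0)
    (hdiv : VectorCalculus.IsDivFree U)
    (heq : ∀ y, -(ν • Laplacian.laplacian U y) + a • U y + a • fderiv ℝ U y y
      + (B (U y) - fderiv ℝ U y (B y)) + convect U U y + gradient P y = 0)
    (hbdd : ∃ M : ℝ, ∀ y, ‖U y‖ ≤ M)
    (hfeed : ∀ y, curl U y ≠ 0 →
      ⟪(WithLp.toLp 2 ![(B (EuclideanSpace.single 1 1)) 2, (B (EuclideanSpace.single 2 1)) 0,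
          (B (EuclideanSpace.single 0 1)) 1] : EuclideanSpace ℝ (Fin 3)), fderiv ℝ U y (curl U y)⟫
        < a * ‖curl U y‖ ^ 2) :
    ∃ b : EuclideanSpace ℝ (Fin 3), ∀ y, U y = b := by
  set β : EuclideanSpace ℝ (Fin 3) := (WithLp.toLp 2 ![(B (EuclideanSpace.single 1 1)) 2,
    (B (EuclideanSpace.single 2 1)) 0, (B (EuclideanSpace.single 0 1)) 1] : EuclideanSpace ℝ (Fin 3))
    with hβ
  have hU2 : ContDiff ℝ 2 U := hU.of_le (by norm_cast)
  have hU3 : ContDiff ℝ 3 U := hU.of_le (by norm_cast)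
  have hω2 : ContDiff ℝ 2 (curl U) := contDiff_curl (n := 2) (by exact_mod_cast hU3)
  have hΘ : ContDiff ℝ 2 (fun z => headPressure a U P z - ⟪B z, U z⟫) :=
    (contDiff_headPressure hU2 hP).sub ((B.contDiff (n := 2)).inner ℝ hU2)
  have hspin : (fun z => -(∑ l, (B (fderiv ℝ U z (EuclideanSpace.single l 1))) l))
      = fun z => ⟪β, curl U z⟫ := funext fun z => by
    rw [curl_eq_curlCLM]; exact neg_sum_clm_apply_eq_inner_axial_curlCLM B hB _
  have hσ2 : ContDiff ℝ 2 (fun z => -(∑ l, (B (fderiv ℝ U z (EuclideanSpace.single l 1))) l)) := by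
    rw [hspin]; exact contDiff_const.inner ℝ hω2
  set Ψ : EuclideanSpace ℝ (Fin 3) → ℝ := fun z => (headPressure a U P z - ⟪B z, U z⟫)
    + (ν / a) * (-(∑ l, (B (fderiv ℝ U z (EuclideanSpace.single l 1))) l)) with hΨ
  have hΨ2 : ContDiff ℝ 2 Ψ := hΘ.add (contDiff_const.mul hσ2)
  -- the source is nonnegative under the feed hypothesis
  have hsrc : ∀ y, 0 ≤ ν * ‖curl U y‖ ^ 2 - (ν / a) * ⟪β, fderiv ℝ U y (curl U y)⟫ := by
    intro y
    by_cases h : curl U y = 0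
    · rw [h]; simp
    · have h1 := hfeed y h
      have h2 : (ν / a) * ⟪β, fderiv ℝ U y (curl U y)⟫ ≤ (ν / a) * (a * ‖curl U y‖ ^ 2) :=
        mul_le_mul_of_nonneg_left h1.le (by positivity)
      have h3 : (ν / a) * (a * ‖curl U y‖ ^ 2) = ν * ‖curl U y‖ ^ 2 := by
        field_simp
      linarith
  have hsub : ∀ y, 0 ≤ driftOp ν a (fun z => U z - B z) Ψ y := fun y => by
    rw [hΨ, driftOp_rotatingHead_add_spin_eq hU hP hB hdiv heq ha.ne' y]; exact hsrc y
  -- polynomial growth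
  obtain ⟨C₁, N₁, hC₁⟩ := stub_rssHeadGrowth ν a hν ha B U P hU hP hB hdiv heq hbdd
  obtain ⟨C₂, N₂, hC₂0, hC₂⟩ := rotatedProfile_poly_bound_fderiv ν a hν ha B U P hU hP hB hdiv heq hbdd
  have hgrowth : ∀ y, |Ψ y| ≤ (|C₁| + ν / a * (‖β‖ * (‖curlCLM‖ * C₂))) * (1 + ‖y‖) ^ (N₁ + N₂) := by
    intro y
    have ht : 1 ≤ 1 + ‖y‖ := by linarith [norm_nonneg y]
    have h1 : |headPressure a U P y - ⟪B y, U y⟫| ≤ |C₁| * (1 + ‖y‖) ^ (N₁ + N₂) :=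
      calc |headPressure a U P y - ⟪B y, U y⟫| ≤ C₁ * (1 + ‖y‖) ^ N₁ := hC₁ y
        _ ≤ |C₁| * (1 + ‖y‖) ^ N₁ := by gcongr; exact le_abs_self _
        _ ≤ |C₁| * (1 + ‖y‖) ^ (N₁ + N₂) :=
            mul_le_mul_of_nonneg_left (pow_le_pow_right₀ ht (Nat.le_add_right _ _)) (abs_nonneg _)
    have h2 : |(ν / a) * (-(∑ l, (B (fderiv ℝ U y (EuclideanSpace.single l 1))) l))|
        ≤ ν / a * (‖β‖ * (‖curlCLM‖ * C₂)) * (1 + ‖y‖) ^ (N₁ + N₂) := by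
      have hs : -(∑ l, (B (fderiv ℝ U y (EuclideanSpace.single l 1))) l) = ⟪β, curl U y⟫ :=
        congrFun hspin y
      rw [hs, abs_mul, abs_of_pos (by positivity : 0 < ν / a)]
      calc ν / a * |⟪β, curl U y⟫| ≤ ν / a * (‖β‖ * ‖curl U y‖) := by
            gcongr; exact abs_real_inner_le_norm _ _
        _ ≤ ν / a * (‖β‖ * (‖curlCLM‖ * ‖fderiv ℝ U y‖)) := by gcongr; exact norm_curl_le U y
        _ ≤ ν / a * (‖β‖ * (‖curlCLM‖ * (C₂ * (1 + ‖y‖) ^ N₂))) := by gcongr; exact hC₂ y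
        _ ≤ ν / a * (‖β‖ * (‖curlCLM‖ * (C₂ * (1 + ‖y‖) ^ (N₁ + N₂)))) := by
            gcongr _ * (_ * (_ * (_ * ?_)))
            exact pow_le_pow_right₀ ht (Nat.le_add_left _ _)
        _ = ν / a * (‖β‖ * (‖curlCLM‖ * C₂)) * (1 + ‖y‖) ^ (N₁ + N₂) := by ring
    calc |Ψ y| ≤ |headPressure a U P y - ⟪B y, U y⟫|
          + |(ν / a) * (-(∑ l, (B (fderiv ℝ U y (EuclideanSpace.single l 1))) l))| := abs_add_le _ _
      _ ≤ _ := by rw [add_mul]; exact add_le_add h1 h2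
  have hconst := isConst_of_driftOp_nonneg_skew_of_poly hν ha hB hΨ2 hsub hbdd hgrowth
  -- the vorticity vanishes identically
  have hcurl : ∀ y, curl U y = 0 := by
    by_contra hne
    push Not at hne
    obtain ⟨y₀, hy₀⟩ := hne
    have hΨfun : Ψ = fun _ => Ψ y₀ := funext fun z => hconst z y₀
    have h0 : driftOp ν a (fun z => U z - B z) Ψ y₀ = 0 := by
      rw [hΨfun]; exact driftOp_const _ _ _
    rw [hΨ, driftOp_rotatingHead_add_spin_eq hU hP hB hdiv heq ha.ne' y₀] at h0
    have h1 := hfeed y₀ hy₀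
    have h2 : (ν / a) * ⟪β, fderiv ℝ U y₀ (curl U y₀)⟫ < (ν / a) * (a * ‖curl U y₀‖ ^ 2) :=
      mul_lt_mul_of_pos_left h1 (by positivity)
    have h3 : (ν / a) * (a * ‖curl U y₀‖ ^ 2) = ν * ‖curl U y₀‖ ^ 2 := by field_simp
    linarith
  obtain ⟨M, hM⟩ := hbdd
  exact ⟨U 0, fun y => eq_of_curl_eq_zero_of_isDivFree_of_bounded hU2 hcurl hdiv hM y 0⟩

/-- **Second reduction of the crux.**  If every smooth bounded rotated Leray profile (all
`ν, a > 0`, all skew `B`) has spin strain feed `⟪β, DU ω⟫ < a|ω|²` off its irrotational set, then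
`NoCoRotatingCore` (every such profile is constant, `rotatedProfile_const_of_spinFeed_lt`, and
`noCoRotatingCore_iff_rotatedProfileLiouville`).  The hypothesis is NOT proved here.
[cite: PineauVicol2026, Conjecture 1.1 (arXiv:2607.09619 p. 3)] -/
theorem noCoRotatingCore_of_spinFeed_lt
    (h : ∀ (ν a : ℝ), 0 < ν → 0 < a → ∀ (B : EuclideanSpace ℝ (Fin 3) →L[ℝ] EuclideanSpace ℝ (Fin 3))
      (U : EuclideanSpace ℝ (Fin 3) → EuclideanSpace ℝ (Fin 3)) (P : EuclideanSpace ℝ (Fin 3) → ℝ),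
      ContDiff ℝ (⊤ : ℕ∞) U → ContDiff ℝ 2 P → (∀ x, inner ℝ (B x) x = 0) →
      VectorCalculus.IsDivFree U →
      (∀ y, -(ν • Laplacian.laplacian U y) + a • U y + a • fderiv ℝ U y y
        + (B (U y) - fderiv ℝ U y (B y)) + convect U U y + gradient P y = 0) →
      (∃ M : ℝ, ∀ y, ‖U y‖ ≤ M) →
      ∀ y, curl U y ≠ 0 →
        ⟪(WithLp.toLp 2 ![(B (EuclideanSpace.single 1 1)) 2, (B (EuclideanSpace.single 2 1)) 0,
            (B (EuclideanSpace.single 0 1)) 1] : EuclideanSpace ℝ (Fin 3)), fderiv ℝ U y (curl U y)⟫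
          < a * ‖curl U y‖ ^ 2) :
    Summit.NavierStokesRegularity.NavierStokesRegularity.Theses.CoriolisHead.NoCoRotatingCore :=
  noCoRotatingCore_iff_rotatedProfileLiouville.2 fun ν a hν ha B U P hU hP hB hdiv heq hbdd =>
    rotatedProfile_const_of_spinFeed_lt ν a hν ha B U P hU hP hB hdiv heq hbdd
      (h ν a hν ha B U P hU hP hB hdiv heq hbdd)

end Trade

end Summit.NavierStokesRegularity.NavierStokesRegularity.Theorems.CoriolisHead

end
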